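import Summits.Ventures.DiscreteObjects.PP12.FanoFiveOrbits
import Summits.Ventures.DiscreteObjects.PP12.FlagOrbitSums

/-!
# PP(12), order-5 cell: the ORBIT-MATRIX REDUCTION holds — `fanoFiveReduction_holds : FanoFiveReduction` (kernel; Steps C–D)
Framing: lottery ticket; floor = certified bounds/negative ranges.

Cell pub-namedobj (venture DiscreteObjects), target (M), designs gen 15. For a putative projective plane of order 12 with a collineation `σ ≠ 1`, `σ⁵ = 1`
(fixed Fano subplane): the matrix `fanoMat5 r c = |colOrbit5 c ∩ lineRep5 r|` over `F5Idx = (Fin 7 × Fin 2) ⊕ Fin 16` (`FanoFiveOrbits`) satisfies designs g15's typed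
statement `IsFanoFiveOrbitMatrix` (p350564): totals from `Σ_{S} |S ∩ a| = #non-fixed points of a` (`sum_orbitsP_card_filter`), the two `λ = 1` systems from
`OrbitCountPrimeOrder.orbit_row_identity_orbitsP` / `FanoFiveOrbits.orbit_column_identity_orbitsP` (p = 5) with the common fixed elements counted by type
(a tangent line carries exactly its fixed point, an exterior line none; dually). Hence **`fanoFiveReduction_holds`** and
**`noOrderFive_of_noFanoFiveOrbitMatrix : NoFanoFiveOrbitMatrix → NoOrderFiveOrder12`** — the order-5 cell (in print EXCLUDED, Janko–van Trung 1982; designs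
g10's orbit-level replication EMPTY outside the kernel on their structured model) now has a KERNEL reduction to one explicit `30 × 30` finite statement.
CENSUS STATUS of `NoFanoFiveOrbitMatrix` (plain form): UNDECIDED — not run (RULING M17); nothing here asserts it. No `sorry`, no new axioms.
-/

namespace Summit.Ventures.DiscreteObjects.PP12

open Configuration Finset
open scoped Classical

namespace Collineation

variable {P L : Type*} [Membership P L] [ProjectivePlane P L] [Fintype P] [Fintype L] (σ : Collineation P L)

/-! ### Plane-level linear identities for prime order -/

omit [ProjectivePlane P L] [Fintype L] in
/-- Summing `|S ∩ a|` over the non-trivial point orbits counts the non-fixed points of `a` (`σ^p = 1`, `p > 0`). -/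
theorem sum_orbitsP_card_filter {p : ℕ} (hq : σ.onPoints ^ p = 1) (hp : 0 < p) (a : L) :
    ∑ S ∈ σ.orbitsP p, (S.filter fun q => q ∈ a).card = (univ.filter fun q : P => q ∈ a ∧ σ.onPoints q ≠ q).card := by
  set A := univ.filter fun q : P => q ∈ a ∧ σ.onPoints q ≠ q with hA
  have himg : ∀ q ∈ A, orbP σ.onPoints p q ∈ σ.orbitsP p := by
    intro q hq'; rw [hA, mem_filter] at hq'
    exact mem_image.2 ⟨q, mem_filter.2 ⟨mem_univ _, hq'.2.2⟩, rfl⟩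
  rw [Finset.card_eq_sum_card_fiberwise himg]
  refine Finset.sum_congr rfl fun S hS => ?_
  obtain ⟨x, hx, rfl⟩ := mem_image.1 hS
  rw [mem_filter] at hx
  congr 1
  ext q
  simp only [hA, mem_filter, mem_univ, true_and]
  constructor
  · rintro ⟨hqx, hqa⟩
    exact ⟨⟨hqa, σ.not_fixed_of_mem_orbP hq hp hx.2 hqx⟩, orbP_eq_of_mem _ hq hp hqx⟩
  · rintro ⟨⟨hqa, -⟩, he⟩
    exact ⟨by rw [← he]; exact self_mem_orbP _ hp _, hqa⟩

/-- Dually for lines through a point. -/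
theorem sum_lineOrbitsP_card_filter {p : ℕ} (hq : σ.onPoints ^ p = 1) (hp : 0 < p) (q : P) :
    ∑ B ∈ σ.lineOrbitsP p, (B.filter fun m => q ∈ m).card = (univ.filter fun m : L => q ∈ m ∧ σ.onLines m ≠ m).card := by
  have hqL : σ.onLines ^ p = 1 := σ.onLines_pow_eq_one hq
  exact σ.dual.sum_orbitsP_card_filter (a := (q : Dual P)) hqL hp

section Five

variable (h12 : ProjectivePlane.order P L = 12) (hne : σ.onPoints ≠ 1) (hq : σ.onPoints ^ 5 = 1)

/-- A representative line of each row orbit. -/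
noncomputable def lineRep5 (r : F5Idx) : L := (σ.rowOrbit5_spec h12 hne hq r).choose

/-- A representative point of each column orbit. -/
noncomputable def pointRep5 (c : F5Idx) : P := (σ.colOrbit5_spec h12 hne hq c).choose

/-- `lineRep5 r` is not fixed, generates the row orbit, and carries the fixed point `x_k` (tangent rows) resp. no fixed point (exterior rows). -/
theorem lineRep5_spec (r : F5Idx) : σ.onLines (σ.lineRep5 h12 hne hq r) ≠ σ.lineRep5 h12 hne hq r ∧
    σ.rowOrbit5 h12 hne hq r = orbP σ.onLines 5 (σ.lineRep5 h12 hne hq r) ∧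
    (match r with
      | Sum.inl (k, _) => (σ.e7P h12 hne hq k).1 ∈ σ.lineRep5 h12 hne hq r
      | Sum.inr _ => ∀ x : P, σ.onPoints x = x → x ∉ σ.lineRep5 h12 hne hq r) :=
  (σ.rowOrbit5_spec h12 hne hq r).choose_spec

/-- `pointRep5 c` is not fixed, generates the column orbit, and lies on `μ_j` (tangent columns) resp. on no fixed line (exterior columns). -/
theorem pointRep5_spec (c : F5Idx) : σ.onPoints (σ.pointRep5 h12 hne hq c) ≠ σ.pointRep5 h12 hne hq c ∧
    σ.colOrbit5 h12 hne hq c = orbP σ.onPoints 5 (σ.pointRep5 h12 hne hq c) ∧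
    (match c with
      | Sum.inl (j, _) => σ.pointRep5 h12 hne hq c ∈ (σ.e7L h12 hne hq j).1
      | Sum.inr _ => ∀ l : L, σ.onLines l = l → σ.pointRep5 h12 hne hq c ∉ l) :=
  (σ.colOrbit5_spec h12 hne hq c).choose_spec

/-- **The orbit matrix of the plane** (order-5 cell): `fanoMat5 r c = |colOrbit5 c ∩ lineRep5 r|`. -/
noncomputable def fanoMat5 (r c : F5Idx) : ℕ :=
  ((σ.colOrbit5 h12 hne hq c).filter fun q => q ∈ σ.lineRep5 h12 hne hq r).card

/-- **Incidence symmetry:** `fanoMat5 r c = #{m ∈ rowOrbit5 r : pointRep5 c ∈ m}`. -/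
theorem fanoMat5_eq_card_lines (r c : F5Idx) :
    σ.fanoMat5 h12 hne hq r c = ((σ.rowOrbit5 h12 hne hq r).filter fun m => σ.pointRep5 h12 hne hq c ∈ m).card := by
  have hqL : σ.onLines ^ 5 = 1 := σ.onLines_pow_eq_one hq
  obtain ⟨hna, hro, -⟩ := σ.lineRep5_spec h12 hne hq r
  obtain ⟨hpf, hco, -⟩ := σ.pointRep5_spec h12 hne hq c
  unfold fanoMat5
  rw [hro, hco]
  have hs := σ.orbP_incidence_symm hq (by norm_num) (σ.pointRep5 h12 hne hq c) (σ.lineRep5 h12 hne hq r)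
  rw [card_orbP_of_ne _ Nat.prime_five hq hpf, card_orbP_of_ne _ Nat.prime_five hqL hna] at hs
  exact (Nat.eq_of_mul_eq_mul_right (by norm_num) hs).symm

/-- **Row totals:** `12` for tangent rows (one fixed point on the line), `13` for exterior rows. -/
theorem fanoMat5_rowSum (r : F5Idx) : ∑ c : F5Idx, σ.fanoMat5 h12 hne hq r c = FanoFive.total r := by
  set a := σ.lineRep5 h12 hne hq r with ha
  obtain ⟨hna, -, hfix⟩ := σ.lineRep5_spec h12 hne hq r
  have hsum : ∑ c : F5Idx, σ.fanoMat5 h12 hne hq r c = ∑ S ∈ σ.orbitsP 5, (S.filter fun q => q ∈ a).card :=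
    σ.sum_colOrbit5 h12 hne hq (fun S => (S.filter fun q => q ∈ a).card)
  have hsplit := σ.card_points_on_line_split a
  rw [h12, ← σ.sum_orbitsP_card_filter hq (by norm_num) a, ← hsum] at hsplit
  rcases r with ⟨k, t⟩ | e
  · have hF : (univ.filter fun q : P => q ∈ a ∧ σ.onPoints q = q) = {(σ.e7P h12 hne hq k).1} := by
      ext q; rw [mem_filter, mem_singleton]
      exact ⟨fun h => σ.fixed_point_unique_of_not_fixed hna h.2.2 (σ.e7P h12 hne hq k).2 h.2.1 hfix,
        fun h => by rw [h]; exact ⟨mem_univ _, hfix, (σ.e7P h12 hne hq k).2⟩⟩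
    rw [hF, card_singleton] at hsplit
    simp only [FanoFive.total]; omega
  · have hF : (univ.filter fun q : P => q ∈ a ∧ σ.onPoints q = q) = ∅ := by
      rw [filter_eq_empty_iff]; intro q _ h; exact hfix q h.2 h.1
    rw [hF, card_empty] at hsplit
    simp only [FanoFive.total]; omega

/-- **Column totals** (dually). -/
theorem fanoMat5_colSum (c : F5Idx) : ∑ r : F5Idx, σ.fanoMat5 h12 hne hq r c = FanoFive.total c := by
  set q := σ.pointRep5 h12 hne hq c with hqdef
  obtain ⟨hqf, -, hfix⟩ := σ.pointRep5_spec h12 hne hq c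
  have hsum : ∑ r : F5Idx, σ.fanoMat5 h12 hne hq r c = ∑ B ∈ σ.lineOrbitsP 5, (B.filter fun m => q ∈ m).card := by
    rw [← σ.sum_rowOrbit5 h12 hne hq (fun B => (B.filter fun m => q ∈ m).card)]
    exact Finset.sum_congr rfl fun r _ => σ.fanoMat5_eq_card_lines h12 hne hq r c
  have hsplit := σ.card_lines_through_split q
  rw [h12, ← σ.sum_lineOrbitsP_card_filter hq (by norm_num) q, ← hsum] at hsplit
  rcases c with ⟨j, t⟩ | e
  · have hF : (univ.filter fun m : L => q ∈ m ∧ σ.onLines m = m) = {(σ.e7L h12 hne hq j).1} := by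
      ext m; rw [mem_filter, mem_singleton]
      exact ⟨fun h => σ.fixed_line_unique_of_not_fixed hqf h.2.2 (σ.e7L h12 hne hq j).2 h.2.1 hfix,
        fun h => by rw [h]; exact ⟨mem_univ _, hfix, (σ.e7L h12 hne hq j).2⟩⟩
    rw [hF, card_singleton] at hsplit
    simp only [FanoFive.total]; omega
  · have hF : (univ.filter fun m : L => q ∈ m ∧ σ.onLines m = m) = ∅ := by
      rw [filter_eq_empty_iff]; intro m _ h; exact hfix m h.2 h.1
    rw [hF, card_empty] at hsplit
    simp only [FanoFive.total]; omega

/-- **Row inner products** as forced by `λ = 1`. -/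
theorem fanoMat5_rows (r r' : F5Idx) : ∑ c : F5Idx, σ.fanoMat5 h12 hne hq r c * σ.fanoMat5 h12 hne hq r' c = FanoFive.target r r' := by
  have hqL : σ.onLines ^ 5 = 1 := σ.onLines_pow_eq_one hq
  set a := σ.lineRep5 h12 hne hq r with ha
  set a' := σ.lineRep5 h12 hne hq r' with ha'
  obtain ⟨hna, hro, hfix⟩ := σ.lineRep5_spec h12 hne hq r
  obtain ⟨hna', hro', hfix'⟩ := σ.lineRep5_spec h12 hne hq r'
  have hsum : ∑ c : F5Idx, σ.fanoMat5 h12 hne hq r c * σ.fanoMat5 h12 hne hq r' c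
      = ∑ S ∈ σ.orbitsP 5, (S.filter fun q => q ∈ a).card * (S.filter fun q => q ∈ a').card :=
    σ.sum_colOrbit5 h12 hne hq (fun S => (S.filter fun q => q ∈ a).card * (S.filter fun q => q ∈ a').card)
  have hsame : a ∈ orbP σ.onLines 5 a' ↔ r = r' := by
    constructor
    · intro h
      apply σ.rowOrbit5_injective h12 hne hq
      rw [hro, hro']; exact orbP_eq_of_mem σ.onLines hqL (by norm_num) h
    · intro h; rw [ha, ha', h]; exact self_mem_orbP _ (by norm_num) _
  have hid := σ.orbit_row_identity_orbitsP Nat.prime_five hq hna' a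
  rw [h12, ← hsum] at hid
  set F := (univ.filter fun q : P => q ∈ a ∧ q ∈ a' ∧ σ.onPoints q = q).card with hF
  have hF0 : (∀ q : P, σ.onPoints q = q → q ∈ a → q ∈ a' → False) → F = 0 := by
    intro h; rw [hF, card_eq_zero, filter_eq_empty_iff]; intro q _ ⟨h1, h2, h3⟩; exact h q h3 h1 h2
  have hF1 : ∀ y : P, y ∈ a → y ∈ a' → σ.onPoints y = y → (∀ q : P, σ.onPoints q = q → q ∈ a → q = y) → F = 1 := by
    intro y hya hya' hy huniq
    rw [hF, card_eq_one]
    refine ⟨y, ?_⟩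
    ext q
    rw [mem_filter, mem_singleton]
    constructor
    · rintro ⟨-, h1, -, h3⟩; exact huniq q h3 h1
    · intro h; rw [h]; exact ⟨mem_univ _, hya, hya', hy⟩
  rcases r with ⟨k, t⟩ | e <;> rcases r' with ⟨k', t'⟩ | e'
  · -- tangent / tangent : common fixed point iff k = k'
    simp only [FanoFive.target]
    have huniq : ∀ q : P, σ.onPoints q = q → q ∈ a → q = (σ.e7P h12 hne hq k).1 :=
      fun q hqf hqa => σ.fixed_point_unique_of_not_fixed hna hqf (σ.e7P h12 hne hq k).2 hqa hfix
    by_cases hkk : k = k'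
    · subst hkk
      have hFv : F = 1 := hF1 _ hfix hfix' (σ.e7P h12 hne hq k).2 huniq
      rw [hFv] at hid
      by_cases htt : t = t'
      · subst htt; rw [if_pos (hsame.2 rfl)] at hid; rw [if_pos rfl]; omega
      · rw [if_neg (fun h => htt (by have := hsame.1 h; simp only [Sum.inl.injEq, Prod.mk.injEq, true_and] at this; exact this))] at hid
        rw [if_neg (fun h => htt (by simp only [Prod.mk.injEq, true_and] at h; exact h)), if_pos rfl]; omega
    · have hxx : (σ.e7P h12 hne hq k).1 ≠ (σ.e7P h12 hne hq k').1 := fun e => hkk ((σ.e7P h12 hne hq).injective (Subtype.ext e))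
      have hFv : F = 0 := hF0 (fun q hqf hq1 hq2 => hxx ((huniq q hqf hq1).symm.trans
        (σ.fixed_point_unique_of_not_fixed hna' hqf (σ.e7P h12 hne hq k').2 hq2 hfix')))
      rw [hFv, if_neg (fun h => hkk (by have := hsame.1 h; simp only [Sum.inl.injEq, Prod.mk.injEq] at this; exact this.1))] at hid
      rw [if_neg (fun h => hkk (by simp only [Prod.mk.injEq] at h; exact h.1)), if_neg hkk]; omega
  · have hFv : F = 0 := hF0 (fun q hqf _ hq2 => hfix' q hqf hq2)
    rw [hFv, if_neg (fun h => by cases hsame.1 h)] at hid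
    simp only [FanoFive.target]; omega
  · have hFv : F = 0 := hF0 (fun q hqf hq1 _ => hfix q hqf hq1)
    rw [hFv, if_neg (fun h => by cases hsame.1 h)] at hid
    simp only [FanoFive.target]; omega
  · have hFv : F = 0 := hF0 (fun q hqf hq1 _ => hfix q hqf hq1)
    rw [hFv] at hid
    simp only [FanoFive.target]
    by_cases hee : e = e'
    · subst hee; rw [if_pos (hsame.2 rfl)] at hid; rw [if_pos rfl]; omega
    · rw [if_neg (fun h => hee (by have := hsame.1 h; simp only [Sum.inr.injEq] at this; exact this))] at hid
      rw [if_neg hee]; omega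

/-- **Column inner products** as forced by `λ = 1` (dually). -/
theorem fanoMat5_cols (c₁ c₂ : F5Idx) : ∑ r : F5Idx, σ.fanoMat5 h12 hne hq r c₁ * σ.fanoMat5 h12 hne hq r c₂ = FanoFive.target c₁ c₂ := by
  set q := σ.pointRep5 h12 hne hq c₁ with hqdef
  set p := σ.pointRep5 h12 hne hq c₂ with hpdef
  obtain ⟨hqf, hco1, hfix1⟩ := σ.pointRep5_spec h12 hne hq c₁
  obtain ⟨hpf, hco2, hfix2⟩ := σ.pointRep5_spec h12 hne hq c₂
  have hsum : ∑ r : F5Idx, σ.fanoMat5 h12 hne hq r c₁ * σ.fanoMat5 h12 hne hq r c₂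
      = ∑ B ∈ σ.lineOrbitsP 5, (B.filter fun m => q ∈ m).card * (B.filter fun m => p ∈ m).card := by
    rw [← σ.sum_rowOrbit5 h12 hne hq (fun B => (B.filter fun m => q ∈ m).card * (B.filter fun m => p ∈ m).card)]
    refine Finset.sum_congr rfl fun r _ => ?_
    rw [σ.fanoMat5_eq_card_lines h12 hne hq r c₁, σ.fanoMat5_eq_card_lines h12 hne hq r c₂]
  have hsame : q ∈ orbP σ.onPoints 5 p ↔ c₁ = c₂ := by
    constructor
    · intro h
      apply σ.colOrbit5_injective h12 hne hq
      rw [hco1, hco2]; exact orbP_eq_of_mem σ.onPoints hq (by norm_num) h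
    · intro h
      have : q = p := by rw [hqdef, hpdef, h]
      rw [this]; exact self_mem_orbP _ (by norm_num) _
  have hid := σ.orbit_column_identity_orbitsP Nat.prime_five hq hpf q
  rw [h12, ← hsum] at hid
  set G := (univ.filter fun m : L => q ∈ m ∧ p ∈ m ∧ σ.onLines m = m).card with hG
  have hG0 : (∀ m : L, σ.onLines m = m → q ∈ m → p ∈ m → False) → G = 0 := by
    intro h; rw [hG, card_eq_zero, filter_eq_empty_iff]; intro m _ ⟨h1, h2, h3⟩; exact h m h3 h1 h2
  have hG1 : ∀ m₀ : L, q ∈ m₀ → p ∈ m₀ → σ.onLines m₀ = m₀ → (∀ m : L, σ.onLines m = m → q ∈ m → m = m₀) → G = 1 := by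
    intro m₀ h1 h2 h3 huniq
    rw [hG, card_eq_one]
    refine ⟨m₀, ?_⟩
    ext m
    rw [mem_filter, mem_singleton]
    constructor
    · rintro ⟨-, hm1, -, hm3⟩; exact huniq m hm3 hm1
    · intro h; rw [h]; exact ⟨mem_univ _, h1, h2, h3⟩
  rcases c₁ with ⟨j, t⟩ | e <;> rcases c₂ with ⟨j', t'⟩ | e'
  · simp only [FanoFive.target]
    have huniq : ∀ m : L, σ.onLines m = m → q ∈ m → m = (σ.e7L h12 hne hq j).1 :=
      fun m hm hqm => σ.fixed_line_unique_of_not_fixed hqf hm (σ.e7L h12 hne hq j).2 hqm hfix1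
    by_cases hjj : j = j'
    · subst hjj
      have hGv : G = 1 := hG1 _ hfix1 hfix2 (σ.e7L h12 hne hq j).2 huniq
      rw [hGv] at hid
      by_cases htt : t = t'
      · subst htt; rw [if_pos (hsame.2 rfl)] at hid; rw [if_pos rfl]; omega
      · rw [if_neg (fun h => htt (by have := hsame.1 h; simp only [Sum.inl.injEq, Prod.mk.injEq, true_and] at this; exact this))] at hid
        rw [if_neg (fun h => htt (by simp only [Prod.mk.injEq, true_and] at h; exact h)), if_pos rfl]; omega
    · have hμμ : (σ.e7L h12 hne hq j).1 ≠ (σ.e7L h12 hne hq j').1 := fun e => hjj ((σ.e7L h12 hne hq).injective (Subtype.ext e))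
      have hGv : G = 0 := hG0 (fun m hm h1 h2 => hμμ ((huniq m hm h1).symm.trans
        (σ.fixed_line_unique_of_not_fixed hpf hm (σ.e7L h12 hne hq j').2 h2 hfix2)))
      rw [hGv, if_neg (fun h => hjj (by have := hsame.1 h; simp only [Sum.inl.injEq, Prod.mk.injEq] at this; exact this.1))] at hid
      rw [if_neg (fun h => hjj (by simp only [Prod.mk.injEq] at h; exact h.1)), if_neg hjj]; omega
  · have hGv : G = 0 := hG0 (fun m hm _ h2 => hfix2 m hm h2)
    rw [hGv, if_neg (fun h => by cases hsame.1 h)] at hid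
    simp only [FanoFive.target]; omega
  · have hGv : G = 0 := hG0 (fun m hm h1 _ => hfix1 m hm h1)
    rw [hGv, if_neg (fun h => by cases hsame.1 h)] at hid
    simp only [FanoFive.target]; omega
  · have hGv : G = 0 := hG0 (fun m hm h1 _ => hfix1 m hm h1)
    rw [hGv] at hid
    simp only [FanoFive.target]
    by_cases hee : e = e'
    · subst hee; rw [if_pos (hsame.2 rfl)] at hid; rw [if_pos rfl]; omega
    · rw [if_neg (fun h => hee (by have := hsame.1 h; simp only [Sum.inr.injEq] at this; exact this))] at hid
      rw [if_neg hee]; omega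

/-- **All four conjuncts:** the orbit matrix read off the plane satisfies `IsFanoFiveOrbitMatrix`. -/
theorem isFanoFiveOrbitMatrix_ofPlane : IsFanoFiveOrbitMatrix (σ.fanoMat5 h12 hne hq) :=
  ⟨σ.fanoMat5_rowSum h12 hne hq, σ.fanoMat5_colSum h12 hne hq, σ.fanoMat5_rows h12 hne hq, σ.fanoMat5_cols h12 hne hq⟩

end Five

end Collineation

/-- **The orbit-matrix reduction of the order-5 cell holds** (designs g15's typed statement `FanoFiveReduction` is a theorem): every projective plane of
order 12 with a collineation `σ ≠ 1`, `σ⁵ = 1` yields a `30 × 30` matrix satisfying `IsFanoFiveOrbitMatrix`. -/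
theorem fanoFiveReduction_holds : FanoFiveReduction := by
  intro P L _ _ _ _ h12 σ hq hne
  exact ⟨_, σ.isFanoFiveOrbitMatrix_ofPlane h12 hne hq⟩

/-- **Census consequence (pure logic):** if no order-5 orbit matrix exists (`NoFanoFiveOrbitMatrix` — UNDECIDED in this plain form as of 2026-08-23), then no
projective plane of order 12 has a collineation of order 5 (in print: Janko–van Trung 1982). -/
theorem noOrderFive_of_noFanoFiveOrbitMatrix (hno : NoFanoFiveOrbitMatrix) : NoOrderFiveOrder12 :=
  noOrderFive_of_fanoFiveReduction fanoFiveReduction_holds hno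

end Summit.Ventures.DiscreteObjects.PP12
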